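import Summits.BirchSwinnertonDyer.Rank1Residual.X2.HidaLimitRoadIntOther
import Summits.BirchSwinnertonDyer.BirchSwinnertonDyer.Theorems.EisensteinPrimesBSDpOnCellCAccumHelpersFour
import Summits.BirchSwinnertonDyer.BirchSwinnertonDyer.Theorems.WildThreeInclusionFlatToUnrDescent
import Summits.BirchSwinnertonDyer.BirchSwinnertonDyer.Theorems.CongruentShaFreeCutUnrSeriesWeierstrass
import Summits.BirchSwinnertonDyer.BirchSwinnertonDyer.Theorems.ErratumRoadFiveIMCDivRoadFFFittingFrameBOfThm23
import Literature.NumberTheory.EllipticCurves.BDPAnticyclotomicPAdicLFunctionHigherWeight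
import Literature.NumberTheory.EllipticCurves.OrdinaryNewformDatumSelfDualTwist
import Literature.NumberTheory.EllipticCurves.BigGaloisRepSelmer
import Literature.NumberTheory.EllipticCurves.Skinner2016.HidaCongruentMembers
import HarnessLib

/-!
# Crux 4 `BSDpOnCellC` (stmt-BirchSwinnertonDyer-19034), line «telescope» (skeleton of record since 2026-08-29T12:58:48Z):
# the TELESCOPING KERNEL as a tree theorem — road R-β (the sign-free Kolyvagin-direction anticyclotomic divisibility at `f_E`,
# X-slot at `𝔭bar`) from the member divisibilities K1 (`stub_memberDiv`) and the two-variable carrier K2+D3 (`stub_telescopeCarrier`)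

Cell `bsd-eis` (home `run/shared/lean/pub/bsd-eis/`), successor LEAD `cruxlead-19034` g1 for crux 4 `BSDpOnCellC`; `--supports
stmt-BirchSwinnertonDyer-19034`. MATHEMATICS AND LEAN TEXT: ideator `bsd-idea-12` g26–g28 (`Cruxes/BSDpOnCellC/Lines/telescope.lean` §K, commit
d923428bfcdb, sha256 1d5bbb30…), VERBATIM — this file only makes the line's sorry-free in-file glue importable, so that the registered skeleton can shrink
to «imports + stubs + one line» (the record's convention since crystal v8) and so that the road-neutral composition `…OfNamedFactsV16` can be fed by it.
The two hypotheses are the registered stub texts of `stub_memberDiv` (K1) and `stub_telescopeCarrier` (K2+D3) TOKEN FOR TOKEN (inline binders; no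
definition is introduced here).

WHAT THE KERNEL DOES (per member `k`): choose a reading map `b` of the member's coefficient ring (`exists_ringHom_padicCoeffIntegers_padicComplexInt`),
give the member typing its discrete topology, chain K1 `p^c·ι(L_{g_k}) ∈ char(X_{g_k})·𝓞` with the carrier's control inclusion (alg_k)
`p^j·char(X_{g_k})·𝓞 ≤ (ιΦ_k)` and interpolation (an_k) `p^e·ιΨ_k ∈ (ιL_{g_k})` to `ιΦ_k ∣ p^{j+c+e}·ιΨ_k` in `𝓞_{ℂ_p}⟦T⟧`; FLAT DESCENT to
`Φ_k ∣ p^n·Ψ_k` in `R₀⟦T⟧` (`WildThreeInclusionKernel.dvd_of_map_unrToCpInt_dvd`); the two remainder identities turn it into `p^{n_k}·L ∈ (F, X − x_k)`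
in `R₀⟦X⟧⟦T⟧`; lift to the triple ring and apply the landed ACCUMULATION LEMMA `AccumHelpers.dvd_limit_of_members (unrIntegers p)` at `x_∞ = 0`
(instances: `HidaLimitAlgebra.isDiscreteValuationRing_unrIntegers`, `CongruentShaFreeCutUnrSeriesWeierstrass.isAdicComplete_maximalIdeal`,
`(toUnr p).toAlgebra`, `irreducible_natCast_p`) ⇒ `p^a·L ∈ (F, X)`; kill `X` (`constantCoeff`, then `map constantCoeff`) ⇒ `p^a·L(0) = F(0)·G₀` in
`R₀⟦T⟧`; read in `𝓞_{ℂ_p}⟦T⟧` and combine with the two limit clauses (alg∞) `p^j·ιF(0) ∈ char(XAc)·𝓞` and (an∞) `p^e·Q ∈ (ιL(0))`: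
`p^{e+a+j}·Q ∈ char(XAc(E/K) strict at 𝔭bar)·𝓞_{ℂ_p}⟦T⟧` — which is `X2.NonsplitKolyvaginDivOnTreeIntOther W p` / `X2.SplitKolyvaginDivOnTreeIntOther W p`
with the sign binder idle (road R-β, both signs).

HONEST FRAMING: a CONDITIONAL kernel (K1 and K2 are hypotheses = registered stubs); nothing about any curve is asserted; no summit statement,
no BSD / anticyclotomic IMC / Mazur MC is proved for any curve; 0 cells / labels / tiers move. K1 is print-shaped (Keller–Yin arXiv:2402.12781v2
Thm. 3.0.8, preprint tier); K2 is a research-sized ∃-construction (card `Lines/telescope.md` v1.1.3 §K2 PROOF PLAN).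

References (shape only, nothing asserted): [KellerYin2024] Thm. 3.0.8, §3, §5.1 (arXiv:2402.12781v2); [Castella2020JIMJ] Def. 2.10, Thm. 2.11;
[Nekovar2006] Selmer Complexes §7.8, §8.9, §9.6; [Howard2007] Thm. 3; [SkinnerUrban2014] §3.
-/

set_option autoImplicit false
set_option linter.dupNamespace false

noncomputable section

open scoped Classical MatrixGroups ModularForm

open CongruenceSubgroup WeierstrassCurve NumberField IsDedekindDomain Field PowerSeries
  Literature.NumberTheory.EllipticCurves Literature.NumberTheory.EllipticCurves.GreenbergSelmer
  Literature.NumberTheory.EllipticCurves.ModularForms Literature.NumberTheory.QuadraticFields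
  Literature.NumberTheory.EllipticCurves.Rank1Residual
  Literature.NumberTheory.EllipticCurves.Rank1Residual.Typed
  Literature.NumberTheory.GaloisRepresentations Literature.NumberTheory.GaloisCohomology
  Summit.BirchSwinnertonDyer.Rank1Residual.X11b.AcSelmer
  Summit.BirchSwinnertonDyer.Rank1Residual.X11b.Halves
  Summit.BirchSwinnertonDyer.Rank1Residual.X11b
  Summit.BirchSwinnertonDyer.Rank1Residual Summit.BirchSwinnertonDyer.Rank1Residual.X1
  Summit.BirchSwinnertonDyer.Rank1Residual.X2
open Literature.NumberTheory.EllipticCurves.BigGaloisRep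
open Literature.NumberTheory.EllipticCurves.Castella2018

namespace Summit.BirchSwinnertonDyer.BirchSwinnertonDyer.Theorems.TelescopeKernel

open Summit.BirchSwinnertonDyer.BirchSwinnertonDyer.Theorems

set_option maxHeartbeats 1600000 in
/-- **KERNEL (telescope §K).** Road R-β SIGN-FREE from the member divisibilities K1 (`hDiv` = the registered text of `stub_memberDiv`, Keller–Yin
arXiv:2402.12781v2 Thm. 3.0.8 at one crystalline member, «⊇» up to `p^c`) and the carrier K2+D3 (`hCar` = the registered text of
`stub_telescopeCarrier`): member-wise chaining in `𝓞_{ℂ_p}⟦T⟧`, flat descent to `R₀⟦T⟧`, the remainder identities in `R₀⟦X⟧⟦T⟧`, the landed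
accumulation lemma at `x_∞ = 0`, and the two limit clauses. CONDITIONAL; nothing asserted. Text: ideator bsd-idea-12 g26–g28, verbatim.
[claim: KellerYin2024, status: under-review] [cite: KellerYin2024, Thm. 3.0.8 and §3 (arXiv:2402.12781v2) (shape only)]
[cite: Castella2020JIMJ, Def. 2.10 and Thm. 2.11 (J. Inst. Math. Jussieu 19 (2020) p. 12) (shape only)] -/
theorem kolyvaginDiv_signFree_of_telescope
    (hDiv :
    ∀ (W : WeierstrassCurve ℚ) [W.IsElliptic] [W.IsGloballyMinimal] (p : ℕ) [Fact p.Prime],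
      CellC W p →
      ∀ (N : ℕ) [NeZero N] (K : Type) [Field K] [NumberField K],
        W.conductorNorm ℤ = N →
        IsImaginaryQuadratic K → NumberField.discr K < -4 → SatisfiesHeegnerHypothesis N K →
        Odd (NumberField.discr K) →
        ∀ (κ : ZpExtension K p), κ.IsAnticyclotomic →
          ∀ (γ : Field.absoluteGaloisGroup K) [Fact (κ.IsTopGenerator γ)]
            (𝔭 : HeightOneSpectrum (𝓞 K)), ((p : ℕ) : 𝓞 K) ∈ 𝔭.asIdeal →
            𝔭.asIdeal.ramificationIdx (𝓞 ℚ) = 1 → 𝔭.asIdeal.inertiaDeg (𝓞 ℚ) = 1 →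
            ∀ (𝔭bar : HeightOneSpectrum (𝓞 K)), ((p : ℕ) : 𝓞 K) ∈ 𝔭bar.asIdeal → 𝔭bar ≠ 𝔭 →
              ((Ideal.span {(p : ℤ)}).primesOver (𝓞 K)).ncard = 2 →
            ∀ (ι' : PadicAlgCl p ≃+* ℂ),
              (∀ (w : InfinitePlace K) (k : 𝓞 K), k ∈ 𝔭.asIdeal ↔ ‖ι'.symm (w.embedding (k : K))‖ < 1) →
            ∀ (D : Skinner2016.HidaCongruentForm W p 1),
              (∀ y : coeffField D.g, ι' (D.ι y) = (y : ℂ)) → 2 * ((p : ℤ) - 1) ∣ D.k - 2 →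
              ∀ (b : padicCoeffIntegers D.ι →+* 𝓞_ℂ_[p]),
                (∀ y, ((b y : 𝓞_ℂ_[p]) : ℂ_[p]) =
                  algebraMap (PadicAlgCl p) ℂ_[p] (padicCoeffIntegers.toPadicAlgCl D.ι y)) →
              ∀ (ΩKg : ℂ) (Ωpg : ℂ_[p]) (Lg : UnrSeries p), ΩKg ≠ 0 → ‖Ωpg‖ = 1 →
                IsBDPLFunctionWt ι' 𝔭 κ γ D.g ΩKg Ωpg Lg →
              ∀ [TopologicalSpace (PowerSeries (padicCoeffIntegers D.ι))]
                [ContinuousSMul (PowerSeries (padicCoeffIntegers D.ι))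
                  (BigRepModule (padicCoeffIntegers D.ι) p (Cofree D.Δ.selfDualRep (padicCoeffField D.ι)))],
                ∃ c : ℕ, PowerSeries.C ((p : 𝓞_ℂ_[p]) ^ c) * PowerSeries.map (R1.unrToCpInt p) Lg ∈
                  (XBig.charIdeal κ (D.Δ.selfDualCofreeRepOver K) 𝔭bar
                    (∅ : Set (HeightOneSpectrum (𝓞 K)))).map (PowerSeries.map b))
    (hCar :
    ∀ (W : WeierstrassCurve ℚ) [W.IsElliptic] [W.IsGloballyMinimal] (p : ℕ) [Fact p.Prime],
    ∀ (N : ℕ) [NeZero N] (K : Type) [Field K] [NumberField K] (Dt : ModularParametrizationData W N)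
      (H : HeegnerDatum N (NumberField.discr K)) (ιK : K →+* ℂ) (P : (W.baseChange K).toAffine.Point),
      CellC W p → W.conductorNorm ℤ = N →
      IsImaginaryQuadratic K → NumberField.discr K < -4 → SatisfiesHeegnerHypothesis N K →
      (W.quadraticTwist (NumberField.discr K : ℚ)).entireLFunction 1 ≠ 0 →
      WeierstrassCurve.Affine.Point.map ιK.toRatAlgHom P = heegnerPointComplex Dt H →
      ¬ (p : ℤ) ∣ Dt.c → ¬ IsOfFinAddOrder P →
      Odd (NumberField.discr K) →
      ∀ (κ : ZpExtension K p), κ.IsAnticyclotomic →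
        ∀ (γ : Field.absoluteGaloisGroup K) [Fact (κ.IsTopGenerator γ)]
          (𝔭 : HeightOneSpectrum (𝓞 K)), ((p : ℕ) : 𝓞 K) ∈ 𝔭.asIdeal →
          𝔭.asIdeal.ramificationIdx (𝓞 ℚ) = 1 → 𝔭.asIdeal.inertiaDeg (𝓞 ℚ) = 1 →
          ∀ (𝔭bar : HeightOneSpectrum (𝓞 K)), ((p : ℕ) : 𝓞 K) ∈ 𝔭bar.asIdeal → 𝔭bar ≠ 𝔭 →
            ((Ideal.span {(p : ℤ)}).primesOver (𝓞 K)).ncard = 2 →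
          ∀ (f : CuspForm (CongruenceSubgroup.Gamma0 N) 2), IsNewformOf W f →
            ∀ (ι' : PadicAlgCl p ≃+* ℂ),
              (∀ (w : InfinitePlace K) (k : 𝓞 K),
                k ∈ 𝔭.asIdeal ↔ ‖ι'.symm (w.embedding (k : K))‖ < 1) →
              ∀ (ΩK : ℂ) (Ωp : ℂ_[p]) (Q : PowerSeries 𝓞_ℂ_[p]), ΩK ≠ 0 → ‖Ωp‖ = 1 →
                R1.IsBDPLFunctionInt p ι' 𝔭 κ γ f ΩK Ωp Q →
      ∃ (F L : PowerSeries (PowerSeries (unrIntegers p))) (x : ℕ → ℤ_[p]),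
        (∀ k, ‖x k‖ < 1) ∧ Filter.Tendsto x Filter.atTop (nhds 0) ∧
        ¬ (PowerSeries.C (PowerSeries.X : PowerSeries (unrIntegers p)) ∣ F) ∧
        (∃ j : ℕ, PowerSeries.C ((p : 𝓞_ℂ_[p]) ^ j) *
            PowerSeries.map (R1.unrToCpInt p) (PowerSeries.map (PowerSeries.constantCoeff (R := unrIntegers p)) F) ∈
          (XAc.charIdeal (W.baseChange K) p κ 𝔭bar ∅ γ).map (PowerSeries.map (R1.toCpInt p))) ∧
        (∃ e : ℕ, PowerSeries.C ((p : 𝓞_ℂ_[p]) ^ e) * Q ∈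
          Ideal.span {PowerSeries.map (R1.unrToCpInt p) (PowerSeries.map (PowerSeries.constantCoeff (R := unrIntegers p)) L)}) ∧
        ∀ k : ℕ, ∃ (D : Skinner2016.HidaCongruentForm W p 1),
          (∀ y : coeffField D.g, ι' (D.ι y) = (y : ℂ)) ∧ 2 * ((p : ℤ) - 1) ∣ D.k - 2 ∧
          ∃ (ΩKg : ℂ) (Ωpg : ℂ_[p]) (Lg : UnrSeries p), ΩKg ≠ 0 ∧ ‖Ωpg‖ = 1 ∧
            IsBDPLFunctionWt ι' 𝔭 κ γ D.g ΩKg Ωpg Lg ∧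
          ∃ (Φ Ψ : UnrSeries p),
            (∃ G U : PowerSeries (PowerSeries (unrIntegers p)),
              PowerSeries.map (PowerSeries.C (R := unrIntegers p)) Φ =
                F * G + PowerSeries.C (PowerSeries.X - PowerSeries.C (toUnr p (x k))) * U) ∧
            (∃ U : PowerSeries (PowerSeries (unrIntegers p)),
              PowerSeries.map (PowerSeries.C (R := unrIntegers p)) Ψ =
                L + PowerSeries.C (PowerSeries.X - PowerSeries.C (toUnr p (x k))) * U) ∧
            (∃ e : ℕ, PowerSeries.C ((p : 𝓞_ℂ_[p]) ^ e) * PowerSeries.map (R1.unrToCpInt p) Ψ ∈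
              Ideal.span {PowerSeries.map (R1.unrToCpInt p) Lg}) ∧
            ∀ (b : padicCoeffIntegers D.ι →+* 𝓞_ℂ_[p]),
              (∀ y, ((b y : 𝓞_ℂ_[p]) : ℂ_[p]) =
                algebraMap (PadicAlgCl p) ℂ_[p] (padicCoeffIntegers.toPadicAlgCl D.ι y)) →
            ∀ [TopologicalSpace (PowerSeries (padicCoeffIntegers D.ι))]
              [ContinuousSMul (PowerSeries (padicCoeffIntegers D.ι))
                (BigRepModule (padicCoeffIntegers D.ι) p (Cofree D.Δ.selfDualRep (padicCoeffField D.ι)))],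
              ∃ j : ℕ, Ideal.span {PowerSeries.C ((p : 𝓞_ℂ_[p]) ^ j)} *
                  (XBig.charIdeal κ (D.Δ.selfDualCofreeRepOver K) 𝔭bar
                    (∅ : Set (HeightOneSpectrum (𝓞 K)))).map (PowerSeries.map b) ≤
                Ideal.span {PowerSeries.map (R1.unrToCpInt p) Φ}) :
    ∀ (W : WeierstrassCurve ℚ) [W.IsElliptic] [W.IsGloballyMinimal] (p : ℕ) [Fact p.Prime],
    ∀ (N : ℕ) [NeZero N] (K : Type) [Field K] [NumberField K] (Dt : ModularParametrizationData W N)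
      (H : HeegnerDatum N (NumberField.discr K)) (ιK : K →+* ℂ) (P : (W.baseChange K).toAffine.Point),
      CellC W p → W.conductorNorm ℤ = N →
      IsImaginaryQuadratic K → NumberField.discr K < -4 → SatisfiesHeegnerHypothesis N K →
      (W.quadraticTwist (NumberField.discr K : ℚ)).entireLFunction 1 ≠ 0 →
      WeierstrassCurve.Affine.Point.map ιK.toRatAlgHom P = heegnerPointComplex Dt H →
      ¬ (p : ℤ) ∣ Dt.c → ¬ IsOfFinAddOrder P →
      Odd (NumberField.discr K) →
      ∀ (κ : ZpExtension K p), κ.IsAnticyclotomic →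
        ∀ (γ : Field.absoluteGaloisGroup K) [Fact (κ.IsTopGenerator γ)]
          (𝔭 : HeightOneSpectrum (𝓞 K)), ((p : ℕ) : 𝓞 K) ∈ 𝔭.asIdeal →
          𝔭.asIdeal.ramificationIdx (𝓞 ℚ) = 1 → 𝔭.asIdeal.inertiaDeg (𝓞 ℚ) = 1 →
          ∀ (𝔭bar : HeightOneSpectrum (𝓞 K)), ((p : ℕ) : 𝓞 K) ∈ 𝔭bar.asIdeal → 𝔭bar ≠ 𝔭 →
            ((Ideal.span {(p : ℤ)}).primesOver (𝓞 K)).ncard = 2 →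
          ∀ (f : CuspForm (CongruenceSubgroup.Gamma0 N) 2), IsNewformOf W f →
            ∀ (ι' : PadicAlgCl p ≃+* ℂ),
              (∀ (w : InfinitePlace K) (k : 𝓞 K),
                k ∈ 𝔭.asIdeal ↔ ‖ι'.symm (w.embedding (k : K))‖ < 1) →
              ∀ (ΩK : ℂ) (Ωp : ℂ_[p]) (Q : PowerSeries 𝓞_ℂ_[p]), ΩK ≠ 0 → ‖Ωp‖ = 1 →
                R1.IsBDPLFunctionInt p ι' 𝔭 κ γ f ΩK Ωp Q →
                ∃ k : ℕ, PowerSeries.C ((p : 𝓞_ℂ_[p]) ^ k) * Q ∈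
                  (XAc.charIdeal (W.baseChange K) p κ 𝔭bar ∅ γ).map (PowerSeries.map (R1.toCpInt p)) := by
  intro W _ _ p _ N _ K _ _ Dt H ιK P hC hN hK hdisc hHeeg hL1 hP hc hfin hodd κ hκ γ _ 𝔭 h𝔭 hram hdeg 𝔭bar
    h𝔭bar hne hsp f hf ι' hι' ΩK Ωp Q hΩK hΩp hQ
  obtain ⟨F, L, x, hxk, hconv, hF, ⟨j₀, hj₀⟩, ⟨e₀, he₀⟩, hmem⟩ :=
    hCar W p N K Dt H ιK P hC hN hK hdisc hHeeg hL1 hP hc hfin hodd κ hκ γ 𝔭 h𝔭 hram hdeg 𝔭bar h𝔭bar hne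
      hsp f hf ι' hι' ΩK Ωp Q hΩK hΩp hQ
  -- the receptacle `R₀ = unrIntegers p`: a complete DVR with uniformiser `p`, a `ℤ_p`-algebra through `toUnr p`
  haveI := HidaLimitAlgebra.isDiscreteValuationRing_unrIntegers (p := p)
  haveI : IsAdicComplete (IsLocalRing.maximalIdeal (unrIntegers p)) (unrIntegers p) :=
    CongruentShaFreeCutUnrSeriesWeierstrass.isAdicComplete_maximalIdeal
  letI : Algebra ℤ_[p] (unrIntegers p) := (toUnr p).toAlgebra
  have halg : ∀ z : ℤ_[p], algebraMap ℤ_[p] (unrIntegers p) z = toUnr p z := fun z => rfl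
  have hirr : Irreducible ((p : ℕ) : unrIntegers p) := HidaLimitAlgebra.irreducible_natCast_p
  -- §1 member-wise: `p^{n_k} · L ∈ (F, X - x_k)` in `R₀⟦X⟧⟦T⟧`
  have hmem₂ : ∀ k : ℕ, ∃ (n : ℕ) (G U : PowerSeries (PowerSeries (unrIntegers p))),
      PowerSeries.C (PowerSeries.C (((p : ℕ) : unrIntegers p) ^ n)) * L =
        F * G + PowerSeries.C (PowerSeries.X - PowerSeries.C (toUnr p (x k))) * U := by
    intro k
    obtain ⟨D, hDι, hpar, ΩKg, Ωpg, Lg, hΩKg, hΩpg, hLg, Φ, Ψ, ⟨GΦ, UΦ, hΦ⟩, ⟨UΨ, hΨ⟩, ⟨e, he⟩,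
      hchar⟩ := hmem k
    obtain ⟨b, hb⟩ := exists_ringHom_padicCoeffIntegers_padicComplexInt D.ι
    letI : TopologicalSpace (PowerSeries (padicCoeffIntegers D.ι)) := ⊥
    haveI : DiscreteTopology (PowerSeries (padicCoeffIntegers D.ι)) := ⟨rfl⟩
    obtain ⟨j, hj⟩ := hchar b hb
    obtain ⟨c, hc⟩ := hDiv W p hC N K hN hK hdisc hHeeg hodd κ hκ γ 𝔭 h𝔭 hram hdeg 𝔭bar h𝔭bar hne hsp
      ι' hι' D hDι hpar b hb ΩKg Ωpg Lg hΩKg hΩpg hLg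
    -- in `𝓞_{ℂ_p}⟦T⟧`: `ι Φ ∣ p^{j+c+e} · ι Ψ`
    have h1 : PowerSeries.C ((p : 𝓞_ℂ_[p]) ^ j) *
        (PowerSeries.C ((p : 𝓞_ℂ_[p]) ^ c) * PowerSeries.map (R1.unrToCpInt p) Lg) ∈
        Ideal.span {PowerSeries.map (R1.unrToCpInt p) Φ} :=
      hj (Ideal.mul_mem_mul (Ideal.mem_span_singleton_self _) hc)
    obtain ⟨r, hr⟩ := Ideal.mem_span_singleton'.mp he
    have h2 : PowerSeries.map (R1.unrToCpInt p) Φ ∣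
        PowerSeries.C ((p : 𝓞_ℂ_[p]) ^ (j + c + e)) * PowerSeries.map (R1.unrToCpInt p) Ψ := by
      have h1' := Ideal.mem_span_singleton.mp h1
      have h2' : PowerSeries.C ((p : 𝓞_ℂ_[p]) ^ (j + c + e)) * PowerSeries.map (R1.unrToCpInt p) Ψ =
          PowerSeries.C ((p : 𝓞_ℂ_[p]) ^ j) *
            (PowerSeries.C ((p : 𝓞_ℂ_[p]) ^ c) * PowerSeries.map (R1.unrToCpInt p) Lg) * r := by
        rw [pow_add, pow_add, map_mul, map_mul, mul_assoc, mul_assoc, ← hr]; ring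
      rw [h2']
      exact dvd_mul_of_dvd_left h1' r
    -- flat descent of the divisibility to `R₀⟦T⟧`
    have h3 : Φ ∣ PowerSeries.C (((p : ℕ) : unrIntegers p) ^ (j + c + e)) * Ψ := by
      refine WildThreeInclusionKernel.dvd_of_map_unrToCpInt_dvd ?_
      simpa only [map_mul, PowerSeries.map_C, map_pow, map_natCast] using h2
    obtain ⟨q, hq⟩ := h3
    refine ⟨j + c + e, GΦ * PowerSeries.map (PowerSeries.C (R := unrIntegers p)) q,
      UΦ * PowerSeries.map (PowerSeries.C (R := unrIntegers p)) q -
        PowerSeries.C (PowerSeries.C (((p : ℕ) : unrIntegers p) ^ (j + c + e))) * UΨ, ?_⟩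
    have key := congrArg (PowerSeries.map (PowerSeries.C (R := unrIntegers p))) hq
    rw [map_mul, map_mul, PowerSeries.map_C, hΦ, hΨ] at key
    linear_combination key
  choose n G U hGU using hmem₂
  -- §2 lift to `R₀⟦X⟧⟦T⟧⟦S⟧` (constants in the idle outer variable) and accumulate at `x_∞ = 0`
  have hmem₃ : ∀ k : ℕ, ∃ G' U' : PowerSeries (PowerSeries (PowerSeries (unrIntegers p))),
      PowerSeries.C (PowerSeries.C (PowerSeries.C (((p : ℕ) : unrIntegers p) ^ n k))) *
          PowerSeries.C L =
        PowerSeries.C F * G' + PowerSeries.C (PowerSeries.C (PowerSeries.X -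
          PowerSeries.C (algebraMap ℤ_[p] (unrIntegers p) (x k)))) * U' := by
    intro k
    refine ⟨PowerSeries.C (G k), PowerSeries.C (U k), ?_⟩
    rw [halg, ← map_mul, hGU k, map_add, map_mul, map_mul]
  have hF₃ : ¬ (PowerSeries.C (PowerSeries.C (PowerSeries.X -
      PowerSeries.C (algebraMap ℤ_[p] (unrIntegers p) 0))) ∣ PowerSeries.C F) := by
    rw [map_zero, map_zero, sub_zero]
    rintro ⟨V, hV⟩
    apply hF
    refine ⟨PowerSeries.constantCoeff V, ?_⟩
    have hV' := congrArg PowerSeries.constantCoeff hV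
    simpa only [map_mul, PowerSeries.constantCoeff_C] using hV'
  have hx0 : ‖(0 : ℤ_[p])‖ < 1 := by simp
  obtain ⟨a, G₃, U₃, hacc⟩ := AccumHelpers.dvd_limit_of_members (unrIntegers p) hirr (PowerSeries.C F)
    (PowerSeries.C L) x 0 n hxk hx0 hconv hmem₃ hF₃
  -- §3 back to `R₀⟦X⟧⟦T⟧`, then to the fibre `X = 0` in `R₀⟦T⟧`
  have hacc₂ : PowerSeries.C (PowerSeries.C (((p : ℕ) : unrIntegers p) ^ a)) * L =
      F * PowerSeries.constantCoeff G₃ +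
        PowerSeries.C PowerSeries.X * PowerSeries.constantCoeff U₃ := by
    have h := congrArg PowerSeries.constantCoeff hacc
    simpa only [map_mul, map_add, PowerSeries.constantCoeff_C, map_zero, sub_zero] using h
  have hfib : PowerSeries.C (((p : ℕ) : unrIntegers p) ^ a) *
        PowerSeries.map (PowerSeries.constantCoeff (R := unrIntegers p)) L =
      PowerSeries.map (PowerSeries.constantCoeff (R := unrIntegers p)) F *
        PowerSeries.map (PowerSeries.constantCoeff (R := unrIntegers p))
          (PowerSeries.constantCoeff G₃) := by
    have h := congrArg (PowerSeries.map (PowerSeries.constantCoeff (R := unrIntegers p))) hacc₂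
    simpa only [map_mul, map_add, PowerSeries.map_C, PowerSeries.constantCoeff_C,
      PowerSeries.constantCoeff_X, map_zero, zero_mul, add_zero] using h
  -- §4 read in `𝓞_{ℂ_p}⟦T⟧` and combine with the two limit clauses
  have hfib' : PowerSeries.C ((p : 𝓞_ℂ_[p]) ^ a) *
        PowerSeries.map (R1.unrToCpInt p)
          (PowerSeries.map (PowerSeries.constantCoeff (R := unrIntegers p)) L) =
      PowerSeries.map (R1.unrToCpInt p)
          (PowerSeries.map (PowerSeries.constantCoeff (R := unrIntegers p)) F) *
        PowerSeries.map (R1.unrToCpInt p)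
          (PowerSeries.map (PowerSeries.constantCoeff (R := unrIntegers p))
            (PowerSeries.constantCoeff G₃)) := by
    have h := congrArg (PowerSeries.map (R1.unrToCpInt p)) hfib
    simpa only [map_mul, PowerSeries.map_C, map_pow, map_natCast] using h
  obtain ⟨r, hr⟩ := Ideal.mem_span_singleton'.mp he₀
  refine ⟨e₀ + a + j₀, ?_⟩
  have hQ' : PowerSeries.C ((p : 𝓞_ℂ_[p]) ^ (e₀ + a + j₀)) * Q =
      (PowerSeries.C ((p : 𝓞_ℂ_[p]) ^ j₀) *
          PowerSeries.map (R1.unrToCpInt p)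
            (PowerSeries.map (PowerSeries.constantCoeff (R := unrIntegers p)) F)) *
        (PowerSeries.map (R1.unrToCpInt p)
            (PowerSeries.map (PowerSeries.constantCoeff (R := unrIntegers p))
              (PowerSeries.constantCoeff G₃)) * r) := by
    rw [pow_add, pow_add, map_mul, map_mul]
    linear_combination (-(PowerSeries.C ((p : 𝓞_ℂ_[p]) ^ a) * PowerSeries.C ((p : 𝓞_ℂ_[p]) ^ j₀))) * hr +
      (PowerSeries.C ((p : 𝓞_ℂ_[p]) ^ j₀) * r) * hfib'
  rw [hQ']
  exact Ideal.mul_mem_right _ _ hj₀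

/-- **Road R-β, BOTH SIGNS, from its sign-free form** — the pair `(∀ W p, CellC → ¬split → X2.NonsplitKolyvaginDivOnTreeIntOther W p) ∧
(∀ W p, CellC → split → X2.SplitKolyvaginDivOnTreeIntOther W p)` that the road-neutral composition `…OfNamedFactsV16.bsdpOnCellC_of_namedFactsV16`
consumes as `hRβ`, from the SIGN-FREE divisibility `h` (e.g. `h := kolyvaginDiv_signFree_of_telescope hDiv hCar`; any other road to the sign-free
statement plugs in the same way — the sign binder of the two `X2` predicates is idle). Pure bookkeeping; CONDITIONAL; nothing asserted.
[claim: KellerYin2024, status: under-review] [cite: KellerYin2024, §3 and §5.2 (arXiv:2402.12781v2) (shape only)] -/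
theorem divRbeta_of_signFree
    (h :
    ∀ (W : WeierstrassCurve ℚ) [W.IsElliptic] [W.IsGloballyMinimal] (p : ℕ) [Fact p.Prime],
    ∀ (N : ℕ) [NeZero N] (K : Type) [Field K] [NumberField K] (Dt : ModularParametrizationData W N)
      (H : HeegnerDatum N (NumberField.discr K)) (ιK : K →+* ℂ) (P : (W.baseChange K).toAffine.Point),
      CellC W p → W.conductorNorm ℤ = N →
      IsImaginaryQuadratic K → NumberField.discr K < -4 → SatisfiesHeegnerHypothesis N K →
      (W.quadraticTwist (NumberField.discr K : ℚ)).entireLFunction 1 ≠ 0 →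
      WeierstrassCurve.Affine.Point.map ιK.toRatAlgHom P = heegnerPointComplex Dt H →
      ¬ (p : ℤ) ∣ Dt.c → ¬ IsOfFinAddOrder P →
      Odd (NumberField.discr K) →
      ∀ (κ : ZpExtension K p), κ.IsAnticyclotomic →
        ∀ (γ : Field.absoluteGaloisGroup K) [Fact (κ.IsTopGenerator γ)]
          (𝔭 : HeightOneSpectrum (𝓞 K)), ((p : ℕ) : 𝓞 K) ∈ 𝔭.asIdeal →
          𝔭.asIdeal.ramificationIdx (𝓞 ℚ) = 1 → 𝔭.asIdeal.inertiaDeg (𝓞 ℚ) = 1 →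
          ∀ (𝔭bar : HeightOneSpectrum (𝓞 K)), ((p : ℕ) : 𝓞 K) ∈ 𝔭bar.asIdeal → 𝔭bar ≠ 𝔭 →
            ((Ideal.span {(p : ℤ)}).primesOver (𝓞 K)).ncard = 2 →
          ∀ (f : CuspForm (CongruenceSubgroup.Gamma0 N) 2), IsNewformOf W f →
            ∀ (ι' : PadicAlgCl p ≃+* ℂ),
              (∀ (w : InfinitePlace K) (k : 𝓞 K),
                k ∈ 𝔭.asIdeal ↔ ‖ι'.symm (w.embedding (k : K))‖ < 1) →
              ∀ (ΩK : ℂ) (Ωp : ℂ_[p]) (Q : PowerSeries 𝓞_ℂ_[p]), ΩK ≠ 0 → ‖Ωp‖ = 1 →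
                R1.IsBDPLFunctionInt p ι' 𝔭 κ γ f ΩK Ωp Q →
                ∃ k : ℕ, PowerSeries.C ((p : 𝓞_ℂ_[p]) ^ k) * Q ∈
                  (XAc.charIdeal (W.baseChange K) p κ 𝔭bar ∅ γ).map (PowerSeries.map (R1.toCpInt p))) :
    (∀ (W : WeierstrassCurve ℚ) [W.IsElliptic] [W.IsGloballyMinimal] (p : ℕ) [Fact p.Prime],
      CellC W p → ¬ W.HasSplitMultiplicativeReductionAtPrime p → NonsplitKolyvaginDivOnTreeIntOther W p) ∧
    (∀ (W : WeierstrassCurve ℚ) [W.IsElliptic] [W.IsGloballyMinimal] (p : ℕ) [Fact p.Prime],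
      CellC W p → W.HasSplitMultiplicativeReductionAtPrime p → SplitKolyvaginDivOnTreeIntOther W p) := by
  refine ⟨fun W _ _ p _ _ _ => ?_, fun W _ _ p _ _ _ => ?_⟩
  · unfold NonsplitKolyvaginDivOnTreeIntOther
    intro N _ K _ _ Dt H ιK P hC _ hN hK hdisc hHeeg hL1 hP hc hfin hodd κ hκ γ _ 𝔭 h𝔭 hram hdeg 𝔭bar
      h𝔭bar hne hsp f hf ι' hι' ΩK Ωp Q hΩK hΩp hQ
    exact h W p N K Dt H ιK P hC hN hK hdisc hHeeg hL1 hP hc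
      hfin hodd κ hκ γ 𝔭 h𝔭 hram hdeg 𝔭bar h𝔭bar hne hsp f hf ι' hι' ΩK Ωp Q hΩK hΩp hQ
  · unfold SplitKolyvaginDivOnTreeIntOther
    intro N _ K _ _ Dt H ιK P hC _ hN hK hdisc hHeeg hL1 hP hc hfin hodd κ hκ γ _ 𝔭 h𝔭 hram hdeg 𝔭bar
      h𝔭bar hne hsp f hf ι' hι' ΩK Ωp Q hΩK hΩp hQ
    exact h W p N K Dt H ιK P hC hN hK hdisc hHeeg hL1 hP hc
      hfin hodd κ hκ γ 𝔭 h𝔭 hram hdeg 𝔭bar h𝔭bar hne hsp f hf ι' hι' ΩK Ωp Q hΩK hΩp hQ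

end Summit.BirchSwinnertonDyer.BirchSwinnertonDyer.Theorems.TelescopeKernel

end
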